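import Summits.QuantumFields.BalabanUV.Beta.GAN24.SourcePairingLevelOneSectors

/-!
# `BalabanUV.Beta.GAN24.SourcePairingSectorsSucc` — binder row G-an2-4 ∕ (CONV-C), the (S) row ∕ (W-γ) one level up, the β-CHAIN (levels ≥ 2), FILE F2a:
# **THE SOURCE PAIRING AT EVERY HIGHER LEVEL SPLITS INTO ITS CUBIC, BORDER AND LAGRANGE SECTORS —
# `X_{j+2}(h; n, φ)[SrecAt (j+1)] = (cE·wE_{j+1})·X_{j+2}[e3OfK Lc G_j (SrecAt j)] + (cVH·wVH_{j+1})·X_{j+2}[vhSAt ρ] + (cΛ·wΛ_{j+1})·X_{j+2}[SΛ_{j+1}]`**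
# (in-block root, every `j`, every weight triple, `h` summable along every direction, bounded `n`, bounded `φ`)
# (G-an2-4 CRUX TEAM (2), seat `b2b-balaban-gan24-formalise-leaf-06` = the (γ) hand, gen 50, file F2a of the successor plan in `LEVELS-GE2.md`)

NOT IN PRINT; OUR BOOKKEEPING ([folklore] BY NAME: leaf-10's `WardLocusRecursive.SrecAt_succ` ∕ `locStencil_SrecAt` (the recursive wall family and its locality), an2's
`SpineRooted.locStencil_e3OfK`, leaf-02 g11's `SrecLinearPartEq.e3K_add` ∕ an3's `ThirdJetKernel.e3K_smul` (linearity of the cubic functional in the stencil), TODAY's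
`SourcePairingLevelOneSectors` §1 (`abs_legPairing_le`, `summable_slot_mul_legPairing`, `e3OfK_eq_e3K'`); 0 `def`, 0 cited fact, 0 `def … : Prop`, 0 sorry).
THIS IS `SourcePairingLevelOneSectors` ONE LEVEL UP: the members of `SrecAt (j+1)` are `e3OfK Lc G_j (SrecAt j)`, `vhSAt ρ`, `SΛ_{j+1} = SLam Lc (lamCoeffK (KInvStep Lc (j+1)) (E2 (j+1)) Lc) (hessFFAt ρ)`
with the weights `cE·wE_{j+1}`, `cVH·wVH_{j+1}`, `cΛ·wΛ_{j+1}` (`SrecAt_succ`, `rfl`).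
HONEST FRAMING (cell contract, verbatim): «discharging `BetaPertH` makes Bałaban's UV stability UNCONDITIONAL — a real constructive-QFT result; it is NOT the continuum limit and NOT
the Clay problem.»  HONEST DEPENDENCY (verbatim): «continuum YM on T⁴ ⇐ BetaPertH ∧ nine spine estimates (0/9 proved); BetaPertH ⇐ (D1) ∧ (D4) ∧ CAP+tail; G-an2-4 gates asym,
D1 and NE2/3/4.»

WHY.  The level induction for road-P2's `hX` (`SourcePairingTowerClosed`, next) evaluates `X_{j+2}[SrecAt (j+1)]` sector by sector: the cubic sector by
`CubicSectorLevelDown.cubicSector_SrecAt_eq_levelDown` + the induction hypothesis, the border sector by leaf-02 g61's PART 2, the Lagrange sector by `LambdaSectorSourcePairingZero` +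
`PeriodicCubeDefectVanishing` §2.  This file is the bookkeeping that splits the pairing.
* §1 `e3OfK_SrecAt_succ_eq_sectors` (the cubic functional of `SrecAt (j+1)` splits, per slot), `legPairing_SrecAt_succ_eq_sectors` (the two-leg pairing splits, per slot; every sector's
  pair family is summable), **`slotSum_SrecAt_succ_eq_sectors`** (the statement in the title).
Asserts NO value of any resolvent column; NOTHING of `hX` at `j ≥ 1` ∕ (W-γ)_{≥2} ∕ (INV) ∕ (S) above level 1 discharged; NEVER «G-an2-4 closed» as (CONV-C); NOT D1, NOT `BetaPertH`,
NOT continuum, NOT Clay.  2026-08-23; no existing file touched.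
-/

noncomputable section

open Finset
open scoped BigOperators
open Literature.MathematicalPhysics.QuantumFieldTheory
open Literature.MathematicalPhysics.QuantumFieldTheory.Balaban1983to89
open Literature.MathematicalPhysics.QuantumFieldTheory.Balaban1983to89.Beta
open B12Sec2to5 (l1 l1_nonneg)
open ExpKernelCalculus (Site MKer BiLoc Decays)
open OneStepResolventKernel (Fib LocStencil biLoc_mono)
open AffineAveraging (Form1 box toSite unitVec dz)
open AveragingHessianKernels (ell)
open AveragingHessianKernelsRooted (vhSAt locStencil_vhSAt hessFFAt)
open InterLevelTransport (SLam)
open StepJetData (locStencil_add locStencil_smul)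
open OneStepKernelFamily (KInvStep colH)
open BalabanStepJetsSucc (E2 lamCoeffK wE wVH wΛ)
open Summit.QuantumFields.BalabanUV.Beta.AxialDressingRooted (coDressKBmAt decays_coDressKBmAt_KInvStep one_le_of_neZero)
open Summit.QuantumFields.BalabanUV.Beta.SpineRooted (e3OfK e3OfK_apply locStencil_e3OfK)
open Summit.QuantumFields.BalabanUV.Beta.WardLocusRecursive (SrecAt SrecAt_succ locStencil_SrecAt)
open Summit.QuantumFields.BalabanUV.Beta.GAN24.ThirdJetKernel (e3K e3K_smul)
open Summit.QuantumFields.BalabanUV.Beta.GAN24.SrecLinearPartEq (e3K_add)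
open Summit.QuantumFields.BalabanUV.Beta.GAN24.LambdaMemberPairing (locStencil_SLam_lamCoeffK)
open Summit.QuantumFields.BalabanUV.Beta.GAN24.SourcePairingLevelOneSectors (abs_legPairing_le summable_slot_mul_legPairing e3OfK_eq_e3K')

namespace Summit.QuantumFields.BalabanUV.Beta.GAN24.SourcePairingSectorsSucc

variable {d : ℕ} {Lc : ℕ} [NeZero Lc] {r : Fin (d + 1) → ℕ}

/-! ## §1 The three sectors of `SrecAt (j+1)`, per entry, per slot, and slot-summed -/

/-- NOT IN PRINT; OUR BOOKKEEPING.  **THE CUBIC FUNCTIONAL OF `SrecAt (j+1)` SPLITS INTO ITS THREE SECTORS** (in-block root `ρ = toSite r`, every `j`, every weight triple, every slot;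
`G_k = coDressKBmAt ρ Lc (KInvStep Lc k)`):
`e3OfK Lc G_{j+1} (SrecAt ρ cE cVH cΛ (j+1)) l t = (cE·wE_{j+1}) • e3OfK Lc G_{j+1} (e3OfK Lc G_j (SrecAt ρ … j)) l t + (cVH·wVH_{j+1}) • e3OfK Lc G_{j+1} (vhSAt ρ) l t + (cΛ·wΛ_{j+1}) • e3OfK Lc G_{j+1} SΛ_{j+1} l t`. -/
theorem e3OfK_SrecAt_succ_eq_sectors (hr : r ∈ box (d + 1) Lc) (cE cVH cΛ : ℝ) (j : ℕ) (l : Fin (d + 1)) (t : Site (d + 1)) :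
    e3OfK Lc (coDressKBmAt (toSite r) Lc (KInvStep (d := d) Lc (j + 1))) (SrecAt d Lc (toSite r) cE cVH cΛ (j + 1)) l t
      = (cE * wE d Lc (j + 1)) • e3OfK Lc (coDressKBmAt (toSite r) Lc (KInvStep (d := d) Lc (j + 1)))
            (e3OfK Lc (coDressKBmAt (toSite r) Lc (KInvStep (d := d) Lc j)) (SrecAt d Lc (toSite r) cE cVH cΛ j)) l t
        + (cVH * wVH d Lc (j + 1)) • e3OfK Lc (coDressKBmAt (toSite r) Lc (KInvStep (d := d) Lc (j + 1))) (fun κ' u' => vhSAt (toSite r) d Lc rfl κ' u') l t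
        + (cΛ * wΛ d Lc (j + 1)) • e3OfK Lc (coDressKBmAt (toSite r) Lc (KInvStep (d := d) Lc (j + 1)))
            (SLam Lc (lamCoeffK (KInvStep (d := d) Lc (j + 1)) (E2 d Lc (j + 1)) Lc) (fun μ y => hessFFAt (toSite r) Lc μ y)) l t := by
  have hLc : 1 ≤ Lc := one_le_of_neZero Lc
  obtain ⟨δG, CG, hδG, hCG, hG⟩ := decays_coDressKBmAt_KInvStep (d := d) hr (j + 1)
  obtain ⟨δG', CG', hδG', hCG', hG'⟩ := decays_coDressKBmAt_KInvStep (d := d) hr j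
  -- the three members are local; the first two are brought to a common rate
  obtain ⟨Cs, δs, hδs, hS⟩ := locStencil_SrecAt (d := d) hLc hr cE cVH cΛ j
  obtain ⟨C1, δ1, hδ1, hT1⟩ := locStencil_e3OfK (N := Lc) hLc ⟨δG', CG', hδG', hCG', hG'⟩ hS hδs
  have hC1 : 0 ≤ C1 := (hT1 0 0).nonneg (Sum.inl 0)
  have h1 : LocStencil (fun κ' u' => (cE * wE d Lc (j + 1)) • e3OfK Lc (coDressKBmAt (toSite r) Lc (KInvStep (d := d) Lc j)) (SrecAt d Lc (toSite r) cE cVH cΛ j) κ' u')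
      (|cE * wE d Lc (j + 1)| * C1) (min δ1 1) :=
    locStencil_smul _ (fun κ' u' => biLoc_mono (hT1 κ' u') hC1 (min_le_left _ _))
  have h2 : LocStencil (fun κ' u' => (cVH * wVH d Lc (j + 1)) • vhSAt (toSite r) d Lc rfl κ' u')
      (|cVH * wVH d Lc (j + 1)| * (3 * (ell (d + 1) Lc : ℝ) ^ 2 * Real.exp (4 * ((d : ℝ) + 1) * Lc * 1))) (min δ1 1) :=
    locStencil_smul _ (fun κ' u' => biLoc_mono (locStencil_vhSAt hLc hr zero_le_one κ' u') (by positivity) (min_le_right _ _))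
  have h12 := locStencil_add h1 h2
  obtain ⟨Cl, δl, hδl, h3⟩ := locStencil_SLam_lamCoeffK (d := d) hr (j + 1)
  have h3' := locStencil_smul (cΛ * wΛ d Lc (j + 1)) h3
  rw [SrecAt_succ]
  simp only [e3OfK_eq_e3K'] at h1 h12 ⊢
  rw [e3K_add hG hδG Lc h12 h3' (lt_min hδ1 one_pos) hδl l t, e3K_add hG hδG Lc h1 h2 (lt_min hδ1 one_pos) (lt_min hδ1 one_pos) l t, e3K_smul, e3K_smul, e3K_smul]

/-- NOT IN PRINT; OUR BOOKKEEPING.  **THE TWO-LEG PAIRING AT LEVEL `j+2` SPLITS INTO ITS THREE SECTORS, PER SLOT** (in-block root, every `j`, every weight triple, every slot, bounded `n`,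
bounded `φ`): `Σ'_{(u,x)} Σ_κκ₂ n κ u·dzφ κ₂ x·e3OfK Lc G_{j+1} (SrecAt ρ … (j+1)) l t u x (inl κ)(inl κ₂) = (cE·wE_{j+1})·(cubic) + (cVH·wVH_{j+1})·(border) + (cΛ·wΛ_{j+1})·(Lagrange)` —
`e3OfK_SrecAt_succ_eq_sectors` per entry; each sector's pair family is summable (`abs_legPairing_le` for the pushed local families). -/
theorem legPairing_SrecAt_succ_eq_sectors (hr : r ∈ box (d + 1) Lc) (cE cVH cΛ : ℝ) (j : ℕ) (l : Fin (d + 1)) (t : Site (d + 1))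
    {n : Form1 (d + 1) ℝ} {Bn : ℝ} (hn : ∀ κ u, |n κ u| ≤ Bn) {φ : Site (d + 1) → ℝ} {Bφ : ℝ} (hφ : ∀ y, |φ y| ≤ Bφ) :
    ∑' ux : Site (d + 1) × Site (d + 1), ∑ κ, ∑ κ₂, n κ ux.1 * dz φ κ₂ ux.2 *
        e3OfK Lc (coDressKBmAt (toSite r) Lc (KInvStep (d := d) Lc (j + 1))) (SrecAt d Lc (toSite r) cE cVH cΛ (j + 1)) l t ux.1 ux.2 (Sum.inl κ) (Sum.inl κ₂)
      = (cE * wE d Lc (j + 1)) * ∑' ux : Site (d + 1) × Site (d + 1), ∑ κ, ∑ κ₂, n κ ux.1 * dz φ κ₂ ux.2 *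
            e3OfK Lc (coDressKBmAt (toSite r) Lc (KInvStep (d := d) Lc (j + 1)))
              (e3OfK Lc (coDressKBmAt (toSite r) Lc (KInvStep (d := d) Lc j)) (SrecAt d Lc (toSite r) cE cVH cΛ j)) l t ux.1 ux.2 (Sum.inl κ) (Sum.inl κ₂)
        + (cVH * wVH d Lc (j + 1)) * ∑' ux : Site (d + 1) × Site (d + 1), ∑ κ, ∑ κ₂, n κ ux.1 * dz φ κ₂ ux.2 *
            e3OfK Lc (coDressKBmAt (toSite r) Lc (KInvStep (d := d) Lc (j + 1))) (fun κ' u' => vhSAt (toSite r) d Lc rfl κ' u') l t ux.1 ux.2 (Sum.inl κ) (Sum.inl κ₂)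
        + (cΛ * wΛ d Lc (j + 1)) * ∑' ux : Site (d + 1) × Site (d + 1), ∑ κ, ∑ κ₂, n κ ux.1 * dz φ κ₂ ux.2 *
            e3OfK Lc (coDressKBmAt (toSite r) Lc (KInvStep (d := d) Lc (j + 1)))
              (SLam Lc (lamCoeffK (KInvStep (d := d) Lc (j + 1)) (E2 d Lc (j + 1)) Lc) (fun μ y => hessFFAt (toSite r) Lc μ y)) l t ux.1 ux.2 (Sum.inl κ) (Sum.inl κ₂) := by
  classical
  have hLc : 1 ≤ Lc := one_le_of_neZero Lc
  obtain ⟨δG, CG, hδG, hCG, hG⟩ := decays_coDressKBmAt_KInvStep (d := d) hr (j + 1)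
  obtain ⟨δG', CG', hδG', hCG', hG'⟩ := decays_coDressKBmAt_KInvStep (d := d) hr j
  set G : MKer (d + 1) (Fib d) := coDressKBmAt (toSite r) Lc (KInvStep (d := d) Lc (j + 1)) with hGdef
  -- the three pushed families are local
  obtain ⟨Cs, δs, hδs, hS⟩ := locStencil_SrecAt (d := d) hLc hr cE cVH cΛ j
  obtain ⟨C0, δ0, hδ0, hT0⟩ := locStencil_e3OfK (N := Lc) hLc ⟨δG', CG', hδG', hCG', hG'⟩ hS hδs
  obtain ⟨C1, δ1, hδ1, hT1⟩ := locStencil_e3OfK (N := Lc) hLc ⟨δG, CG, hδG, hCG, hG⟩ hT0 hδ0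
  obtain ⟨C2, δ2, hδ2, hT2⟩ := locStencil_e3OfK (N := Lc) hLc ⟨δG, CG, hδG, hCG, hG⟩ (locStencil_vhSAt hLc hr zero_le_one) one_pos
  obtain ⟨Cl, δl, hδl, h3⟩ := locStencil_SLam_lamCoeffK (d := d) hr (j + 1)
  obtain ⟨C3, δ3, hδ3, hT3⟩ := locStencil_e3OfK (N := Lc) hLc ⟨δG, CG, hδG, hCG, hG⟩ h3 hδl
  obtain ⟨B1, -, hB1⟩ := abs_legPairing_le hT1 hδ1 hn hφ
  obtain ⟨B2, -, hB2⟩ := abs_legPairing_le hT2 hδ2 hn hφ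
  obtain ⟨B3, -, hB3⟩ := abs_legPairing_le hT3 hδ3 hn hφ
  have hs1 := (hB1 l t).1
  have hs2 := (hB2 l t).1
  have hs3 := (hB3 l t).1
  -- pointwise split of the summand
  have hpt : ∀ ux : Site (d + 1) × Site (d + 1), (∑ κ, ∑ κ₂, n κ ux.1 * dz φ κ₂ ux.2 *
        e3OfK Lc G (SrecAt d Lc (toSite r) cE cVH cΛ (j + 1)) l t ux.1 ux.2 (Sum.inl κ) (Sum.inl κ₂))
      = (cE * wE d Lc (j + 1)) * (∑ κ, ∑ κ₂, n κ ux.1 * dz φ κ₂ ux.2 *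
            e3OfK Lc G (e3OfK Lc (coDressKBmAt (toSite r) Lc (KInvStep (d := d) Lc j)) (SrecAt d Lc (toSite r) cE cVH cΛ j)) l t ux.1 ux.2 (Sum.inl κ) (Sum.inl κ₂))
        + (cVH * wVH d Lc (j + 1)) * (∑ κ, ∑ κ₂, n κ ux.1 * dz φ κ₂ ux.2 * e3OfK Lc G (fun κ' u' => vhSAt (toSite r) d Lc rfl κ' u') l t ux.1 ux.2 (Sum.inl κ) (Sum.inl κ₂))
        + (cΛ * wΛ d Lc (j + 1)) * (∑ κ, ∑ κ₂, n κ ux.1 * dz φ κ₂ ux.2 *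
            e3OfK Lc G (SLam Lc (lamCoeffK (KInvStep (d := d) Lc (j + 1)) (E2 d Lc (j + 1)) Lc) (fun μ y => hessFFAt (toSite r) Lc μ y)) l t ux.1 ux.2
              (Sum.inl κ) (Sum.inl κ₂)) := by
    intro ux
    rw [hGdef, e3OfK_SrecAt_succ_eq_sectors hr cE cVH cΛ j l t]
    simp only [Pi.add_apply, Pi.smul_apply, smul_eq_mul, Finset.mul_sum]
    rw [← Finset.sum_add_distrib, ← Finset.sum_add_distrib]
    refine Finset.sum_congr rfl fun κ _ => ?_
    rw [← Finset.sum_add_distrib, ← Finset.sum_add_distrib]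
    refine Finset.sum_congr rfl fun κ₂ _ => ?_
    ring
  rw [tsum_congr hpt, ((hs1.mul_left _).add (hs2.mul_left _)).tsum_add (hs3.mul_left _), (hs1.mul_left _).tsum_add (hs2.mul_left _),
    tsum_mul_left, tsum_mul_left, tsum_mul_left]

/-- NOT IN PRINT; OUR BOOKKEEPING.  **THE SOURCE PAIRING AT LEVEL `j+2` SPLITS INTO ITS THREE SECTORS** (in-block root `ρ = toSite r`, every `j`, every weight triple `cE cVH cΛ`, `h` summable
along every direction, bounded `n`, bounded `φ`; `X_{j+2}(h; n, φ)[S] := Σ_l Σ'_t h l t·Σ'_{(u,x)} Σ_κκ₂ n κ u·dzφ κ₂ x·e3OfK Lc G_{j+1} S l t u x (inl κ)(inl κ₂)`):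
`X_{j+2}[SrecAt ρ cE cVH cΛ (j+1)] = (cE·wE_{j+1})·X_{j+2}[e3OfK Lc G_j (SrecAt ρ … j)] + (cVH·wVH_{j+1})·X_{j+2}[vhSAt ρ] + (cΛ·wΛ_{j+1})·X_{j+2}[SΛ_{j+1}]`. -/
theorem slotSum_SrecAt_succ_eq_sectors (hr : r ∈ box (d + 1) Lc) (cE cVH cΛ : ℝ) (j : ℕ)
    {h : Form1 (d + 1) ℝ} (hh : ∀ l, Summable (h l)) {n : Form1 (d + 1) ℝ} {Bn : ℝ} (hn : ∀ κ u, |n κ u| ≤ Bn)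
    {φ : Site (d + 1) → ℝ} {Bφ : ℝ} (hφ : ∀ y, |φ y| ≤ Bφ) :
    ∑ l, ∑' t : Site (d + 1), h l t * ∑' ux : Site (d + 1) × Site (d + 1), ∑ κ, ∑ κ₂, n κ ux.1 * dz φ κ₂ ux.2 *
        e3OfK Lc (coDressKBmAt (toSite r) Lc (KInvStep (d := d) Lc (j + 1))) (SrecAt d Lc (toSite r) cE cVH cΛ (j + 1)) l t ux.1 ux.2 (Sum.inl κ) (Sum.inl κ₂)
      = (cE * wE d Lc (j + 1)) * ∑ l, ∑' t : Site (d + 1), h l t * ∑' ux : Site (d + 1) × Site (d + 1), ∑ κ, ∑ κ₂, n κ ux.1 * dz φ κ₂ ux.2 *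
            e3OfK Lc (coDressKBmAt (toSite r) Lc (KInvStep (d := d) Lc (j + 1)))
              (e3OfK Lc (coDressKBmAt (toSite r) Lc (KInvStep (d := d) Lc j)) (SrecAt d Lc (toSite r) cE cVH cΛ j)) l t ux.1 ux.2 (Sum.inl κ) (Sum.inl κ₂)
        + (cVH * wVH d Lc (j + 1)) * ∑ l, ∑' t : Site (d + 1), h l t * ∑' ux : Site (d + 1) × Site (d + 1), ∑ κ, ∑ κ₂, n κ ux.1 * dz φ κ₂ ux.2 *
            e3OfK Lc (coDressKBmAt (toSite r) Lc (KInvStep (d := d) Lc (j + 1))) (fun κ' u' => vhSAt (toSite r) d Lc rfl κ' u') l t ux.1 ux.2 (Sum.inl κ) (Sum.inl κ₂)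
        + (cΛ * wΛ d Lc (j + 1)) * ∑ l, ∑' t : Site (d + 1), h l t * ∑' ux : Site (d + 1) × Site (d + 1), ∑ κ, ∑ κ₂, n κ ux.1 * dz φ κ₂ ux.2 *
            e3OfK Lc (coDressKBmAt (toSite r) Lc (KInvStep (d := d) Lc (j + 1)))
              (SLam Lc (lamCoeffK (KInvStep (d := d) Lc (j + 1)) (E2 d Lc (j + 1)) Lc) (fun μ y => hessFFAt (toSite r) Lc μ y)) l t ux.1 ux.2 (Sum.inl κ) (Sum.inl κ₂) := by
  classical
  have hLc : 1 ≤ Lc := one_le_of_neZero Lc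
  obtain ⟨δG, CG, hδG, hCG, hG⟩ := decays_coDressKBmAt_KInvStep (d := d) hr (j + 1)
  obtain ⟨δG', CG', hδG', hCG', hG'⟩ := decays_coDressKBmAt_KInvStep (d := d) hr j
  set G : MKer (d + 1) (Fib d) := coDressKBmAt (toSite r) Lc (KInvStep (d := d) Lc (j + 1)) with hGdef
  obtain ⟨Cs, δs, hδs, hS⟩ := locStencil_SrecAt (d := d) hLc hr cE cVH cΛ j
  obtain ⟨C0, δ0, hδ0, hT0⟩ := locStencil_e3OfK (N := Lc) hLc ⟨δG', CG', hδG', hCG', hG'⟩ hS hδs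
  obtain ⟨C1, δ1, hδ1, hT1⟩ := locStencil_e3OfK (N := Lc) hLc ⟨δG, CG, hδG, hCG, hG⟩ hT0 hδ0
  obtain ⟨C2, δ2, hδ2, hT2⟩ := locStencil_e3OfK (N := Lc) hLc ⟨δG, CG, hδG, hCG, hG⟩ (locStencil_vhSAt hLc hr zero_le_one) one_pos
  obtain ⟨Cl, δl, hδl, h3⟩ := locStencil_SLam_lamCoeffK (d := d) hr (j + 1)
  obtain ⟨C3, δ3, hδ3, hT3⟩ := locStencil_e3OfK (N := Lc) hLc ⟨δG, CG, hδG, hCG, hG⟩ h3 hδl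
  set FW : Fin (d + 1) → Site (d + 1) → ℝ := fun l t => ∑' ux : Site (d + 1) × Site (d + 1), ∑ κ, ∑ κ₂, n κ ux.1 * dz φ κ₂ ux.2 *
      e3OfK Lc G (e3OfK Lc (coDressKBmAt (toSite r) Lc (KInvStep (d := d) Lc j)) (SrecAt d Lc (toSite r) cE cVH cΛ j)) l t ux.1 ux.2 (Sum.inl κ) (Sum.inl κ₂) with hFW
  set FV : Fin (d + 1) → Site (d + 1) → ℝ := fun l t => ∑' ux : Site (d + 1) × Site (d + 1), ∑ κ, ∑ κ₂, n κ ux.1 * dz φ κ₂ ux.2 *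
      e3OfK Lc G (fun κ' u' => vhSAt (toSite r) d Lc rfl κ' u') l t ux.1 ux.2 (Sum.inl κ) (Sum.inl κ₂) with hFV
  set FL : Fin (d + 1) → Site (d + 1) → ℝ := fun l t => ∑' ux : Site (d + 1) × Site (d + 1), ∑ κ, ∑ κ₂, n κ ux.1 * dz φ κ₂ ux.2 *
      e3OfK Lc G (SLam Lc (lamCoeffK (KInvStep (d := d) Lc (j + 1)) (E2 d Lc (j + 1)) Lc) (fun μ y => hessFFAt (toSite r) Lc μ y)) l t ux.1 ux.2 (Sum.inl κ) (Sum.inl κ₂)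
    with hFL
  have hsW : ∀ l, Summable fun t : Site (d + 1) => h l t * FW l t := fun l => summable_slot_mul_legPairing hT1 hδ1 hn hφ hh l
  have hsV : ∀ l, Summable fun t : Site (d + 1) => h l t * FV l t := fun l => summable_slot_mul_legPairing hT2 hδ2 hn hφ hh l
  have hsL : ∀ l, Summable fun t : Site (d + 1) => h l t * FL l t := fun l => summable_slot_mul_legPairing hT3 hδ3 hn hφ hh l
  -- per slot
  have hslot : ∀ (l : Fin (d + 1)) (t : Site (d + 1)), h l t * (∑' ux : Site (d + 1) × Site (d + 1), ∑ κ, ∑ κ₂, n κ ux.1 * dz φ κ₂ ux.2 *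
        e3OfK Lc G (SrecAt d Lc (toSite r) cE cVH cΛ (j + 1)) l t ux.1 ux.2 (Sum.inl κ) (Sum.inl κ₂))
      = (cE * wE d Lc (j + 1)) * (h l t * FW l t) + (cVH * wVH d Lc (j + 1)) * (h l t * FV l t) + (cΛ * wΛ d Lc (j + 1)) * (h l t * FL l t) := by
    intro l t
    rw [hGdef, legPairing_SrecAt_succ_eq_sectors hr cE cVH cΛ j l t hn hφ]
    ring
  show (∑ l, ∑' t : Site (d + 1), h l t * ∑' ux : Site (d + 1) × Site (d + 1), ∑ κ, ∑ κ₂, n κ ux.1 * dz φ κ₂ ux.2 *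
        e3OfK Lc G (SrecAt d Lc (toSite r) cE cVH cΛ (j + 1)) l t ux.1 ux.2 (Sum.inl κ) (Sum.inl κ₂))
      = (cE * wE d Lc (j + 1)) * ∑ l, ∑' t : Site (d + 1), h l t * FW l t + (cVH * wVH d Lc (j + 1)) * ∑ l, ∑' t : Site (d + 1), h l t * FV l t
        + (cΛ * wΛ d Lc (j + 1)) * ∑ l, ∑' t : Site (d + 1), h l t * FL l t
  have e1 : ∀ l, (∑' t : Site (d + 1), h l t * ∑' ux : Site (d + 1) × Site (d + 1), ∑ κ, ∑ κ₂, n κ ux.1 * dz φ κ₂ ux.2 *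
        e3OfK Lc G (SrecAt d Lc (toSite r) cE cVH cΛ (j + 1)) l t ux.1 ux.2 (Sum.inl κ) (Sum.inl κ₂))
      = (cE * wE d Lc (j + 1)) * ∑' t : Site (d + 1), h l t * FW l t + (cVH * wVH d Lc (j + 1)) * ∑' t : Site (d + 1), h l t * FV l t
        + (cΛ * wΛ d Lc (j + 1)) * ∑' t : Site (d + 1), h l t * FL l t := by
    intro l
    rw [tsum_congr (hslot l), (((hsW l).mul_left _).add ((hsV l).mul_left _)).tsum_add ((hsL l).mul_left _),
      ((hsW l).mul_left _).tsum_add ((hsV l).mul_left _), tsum_mul_left, tsum_mul_left, tsum_mul_left]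
  rw [Finset.sum_congr rfl fun l _ => e1 l, Finset.sum_add_distrib, Finset.sum_add_distrib, ← Finset.mul_sum, ← Finset.mul_sum, ← Finset.mul_sum]

end Summit.QuantumFields.BalabanUV.Beta.GAN24.SourcePairingSectorsSucc

end
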